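import Summits.QuantumAdvantage.QuantumAdvantage.Theorems.NearExactIsExact.Negative.LevelSixSixtyOnePrep
import Summits.QuantumAdvantage.QuantumAdvantage.Theorems.CubicForrelationNearExactIsExactFourteenLevelSixPrep
import Summits.QuantumAdvantage.QuantumAdvantage.Theorems.CubicForrelationNearExactIsExactSecondWeight
import Literature.Computability.QuantumComplexity.ForrelationThreeFoldTables

/-!
# Fourier core of a type-O side with a `2¹⁰`-point digit set (NearExactIsExact, disprover gen 25)

Negative/structural lemmas for the crux `CubicForrelation.NearExactIsExact` (item r2), finite slice `n = 14`; the engine of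
THEOREM TypeO121 (`…Negative.TypeOOneTwentyOneFourteen`: a type-O side caps `Φ ≤ 121/128`).
HONEST FRAMING: statements about Boolean functions on 14 bits — NOT summit progress; no violation of `NearExactIsExact`.

`to_core`: for a quadratic `q` on 14 bits whose form `B_q` has radical `R` with `#R < 2¹²`, and a set `P` of exactly `2¹⁰` points all
of whose differences lie in `R`, the transform of `(−1)^q(1 − 4·1_P)` takes only the values `0, ±8192` (then, by Parseval, at exactly
six frequencies: `to_six_freq`).  Ingredients: the autocorrelation of `(−1)^q` is `±2¹⁴` on `R` and `0` off `R`, so by Wiener–Khinchin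
`((−1)^q)^∧(y)² = 2¹⁴·Σ_{a∈R}(−1)^{q0⊕qa⊕a·y}`, a character sum equal to `0` or `#R`; `#R = 2¹¹` would make `2²⁵` the square of the
integer `((−1)^q)^∧(y)` (`to_W_int`, `to_sq_ne_two_pow_25`), so `#R = 2¹⁰` and `R = a₀ ⊕ P`; then `((−1)^q 1_P)^∧` is `±2⁻²` times
`((−1)^q)^∧` on the common support.

Sources: [this work]; R. O'Donnell (2014) §3.3 (characters of subspaces, Parseval); F. J. MacWilliams, N. J. A. Sloane (1977)
Ch. 15 §2 (symplectic form and radical of a second-order RM word).  Standard axioms only.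
-/

set_option linter.dupNamespace false -- D-0017: single-problem summit ⇒ `QuantumAdvantage.QuantumAdvantage` by design

noncomputable section

namespace Summit.QuantumAdvantage.QuantumAdvantage.Theorems.NearExactIsExact.Negative.TypeOFourierCoreFourteen

open Finset
open Literature.Computability.QuantumComplexity
open Literature.Computability.QuantumComplexity.BuzetChailloux (bxor zeroVec bxor_bxor_cancel_left bxor_zeroVec zeroVec_bxor
  bxor_comm bxor_self signOf_sq)
open Literature.Computability.QuantumComplexity.DerivativeWalsh (W dwt sum_W_sq twist_bxor_left sum_char_subspace W_mul_W_bxor)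
open Summit.QuantumAdvantage.QuantumAdvantage.Theorems.CubicForrelation.NearExactIsExact
open Summit.QuantumAdvantage.QuantumAdvantage.Theorems.SignedCubicForrelationNotPrBPP.Negative.HalfQuad (forrelation_comm)

variable {n : ℕ}

/-! ### Integrality -/

/-- `k² ≠ 2²⁵` for an integer `k` (`5792² < 2²⁵ < 5793²`). [folklore] -/
theorem to_sq_ne_two_pow_25 (k : ℤ) : k ^ 2 ≠ 2 ^ 25 := by
  intro h
  have hkk : |k| * |k| = k ^ 2 := by rw [abs_mul_abs_self, sq]
  rcases le_or_gt |k| 5792 with hk | hk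
  · have h1 : |k| * |k| ≤ 5792 * 5792 := mul_le_mul hk hk (abs_nonneg k) (by norm_num)
    rw [hkk, h] at h1
    norm_num at h1
  · have hk' : (5793 : ℤ) ≤ |k| := by linarith
    have h1 : (5793 : ℤ) * 5793 ≤ |k| * |k| := mul_le_mul hk' hk' (by norm_num) (abs_nonneg k)
    rw [hkk, h] at h1
    norm_num at h1

/-- The Walsh transform of a Boolean sign function is an integer. [folklore] -/
theorem to_W_int (q : (Fin n → Bool) → Bool) (y : Fin n → Bool) : ∃ k : ℤ, W (fun x => signOf (q x)) y = k := by
  refine ⟨∑ x, sZ (q x ^^ decide (Odd (univ.filter fun i => x i && y i).card)), ?_⟩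
  push_cast
  unfold W
  refine sum_congr rfl fun x _ => ?_
  rw [tp_sZ_cast, signOf_xor, vg_twist_eq_signOf]


/-- **Six frequencies.**  A real function on `𝔽₂¹⁴` with values in `{0, ±8192}` and `Σ T² = 2¹⁴ · 24576` has exactly `6`
non-zero values. [folklore] -/
theorem to_six_freq (T : (Fin (7 + 7) → Bool) → ℝ) (hT : ∀ y, T y = 0 ∨ T y = 8192 ∨ T y = -8192)
    (hP : ∑ y, T y ^ 2 = (2 : ℝ) ^ (7 + 7) * 24576) : #(univ.filter fun y => T y ≠ 0) = 6 := by
  classical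
  have hsq : ∀ y, T y ^ 2 = if T y ≠ 0 then (67108864 : ℝ) else 0 := by
    intro y
    rcases hT y with h | h | h <;> rw [h] <;> norm_num
  rw [sum_congr rfl fun y _ => hsq y, ← sum_filter, sum_const, nsmul_eq_mul] at hP
  have h : (#(univ.filter fun y => T y ≠ 0) : ℝ) = 6 := by
    norm_num at hP
    linarith
  exact_mod_cast h


/-! ### The Fourier core: a `2¹⁰`-point digit set whose differences lie in the radical -/

set_option maxHeartbeats 1600000 in
/-- **Fourier core.**  Let `q` be quadratic on 14 bits with form `B(a,b) = q0 ⊕ qa ⊕ qb ⊕ q(a⊕b)` and radical `R`,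
`#R < 2¹²`, and let `P` have exactly `2¹⁰` ones with every difference of two ones in `R`.  Then the transform of
`F₀ = (−1)^q (1 − 4·1_P)` takes only the values `0, ±8192`.
(Wiener–Khinchin: `((−1)^q)^∧(y)² = 2¹⁴ Σ_{a∈R} (−1)^{q0⊕qa⊕a·y}` — the autocorrelation vanishes off `R` and is `±2¹⁴` on it —
so `#R = 2¹¹` would make `2²⁵` the square of an integer; hence `#R = 2¹⁰`, `R = a₀ ⊕ supp P`, the character sum is `0` or
`2¹⁰`, so `((−1)^q)^∧ ∈ {0, ±2¹²}` and `((−1)^q 1_P)^∧ ∈ {0, ±2¹⁰}` with the same support.)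
NOT summit progress. [this work; cite: ODonnell2014, §3.3; MacWilliamsSloane1977, Ch. 15 §2] -/
theorem to_core (q P : (Fin (7 + 7) → Bool) → Bool) (hq : IsDegLeFun 2 q)
    (hP : #(univ.filter fun x : Fin (7 + 7) → Bool => P x = true) = 1024)
    (hrad : ∀ a b : Fin (7 + 7) → Bool, P a = true → P b = true →
      ∀ y, (q zeroVec ^^ q (bxor a b) ^^ q y ^^ q (bxor (bxor a b) y)) = false)
    (hR : ¬ 2 ^ 12 ≤ #(univ.filter fun a : Fin (7 + 7) → Bool => ∀ b, (q zeroVec ^^ q a ^^ q b ^^ q (bxor a b)) = false))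
    (y : Fin (7 + 7) → Bool) :
    W (fun x => signOf (q x) * (1 - 4 * (if P x = true then (1 : ℝ) else 0))) y = 0 ∨
      W (fun x => signOf (q x) * (1 - 4 * (if P x = true then (1 : ℝ) else 0))) y = 8192 ∨
      W (fun x => signOf (q x) * (1 - 4 * (if P x = true then (1 : ℝ) else 0))) y = -8192 := by
  classical
  set R := univ.filter (fun a : Fin (7 + 7) → Bool => ∀ b, (q zeroVec ^^ q a ^^ q b ^^ q (bxor a b)) = false) with hRdef
  have hmemR : ∀ a, a ∈ R ↔ ∀ b, (q zeroVec ^^ q a ^^ q b ^^ q (bxor a b)) = false := fun a => by simp [hRdef]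
  -- the radical: `0 ∈ R`, `⊕`-closed, periods up to the constant `q0 ⊕ qa`
  have h0 : zeroVec ∈ R := by
    rw [hmemR]; intro b; rw [zeroVec_bxor]; cases q zeroVec <;> cases q b <;> rfl
  have hadd : ∀ a ∈ R, ∀ a' ∈ R, bxor a a' ∈ R := by
    intro a ha a' ha'
    rw [hmemR] at ha ha' ⊢
    intro b
    rw [es_B_add_left q hq a a' b, ha b, ha' b]; rfl
  have hper0 : ∀ a ∈ R, ∀ x, q (bxor x a) = (q x ^^ (q zeroVec ^^ q a)) := by
    intro a ha x
    have h := es_second_deriv q hq zeroVec a x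
    rw [zeroVec_bxor, zeroVec_bxor, (hmemR a).1 ha x, bxor_comm a x] at h
    rw [h]
    cases q zeroVec <;> cases q a <;> cases q x <;> rfl
  -- autocorrelation of `(−1)^q`: `±2¹⁴` on `R`, `0` off `R`
  have hDon : ∀ a ∈ R, ∑ x, signOf (q x) * signOf (q (bxor x a)) = 16384 * signOf (q zeroVec ^^ q a) := by
    intro a ha
    have e : ∀ x, signOf (q x) * signOf (q (bxor x a)) = signOf (q zeroVec ^^ q a) := by
      intro x
      rw [hper0 a ha x, signOf_xor, ← mul_assoc, ← pow_two, signOf_sq, one_mul]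
    rw [sum_congr rfl fun x _ => e x, sum_const, card_univ, Fintype.card_fun, Fintype.card_bool, Fintype.card_fin]
    norm_num
  have hDoff : ∀ a, a ∉ R → ∑ x, signOf (q x) * signOf (q (bxor x a)) = 0 := by
    intro a ha
    rw [hmemR] at ha
    push Not at ha
    obtain ⟨b, hb⟩ := ha
    have hb' : (q zeroVec ^^ q a ^^ q b ^^ q (bxor a b)) = true := by simpa using hb
    have hre : ∑ x, signOf (q x) * signOf (q (bxor x a)) =
        ∑ x, signOf (q (bxor x b)) * signOf (q (bxor (bxor x b) a)) :=
      (Fintype.sum_equiv (Equiv.mk (fun x => bxor x b) (fun x => bxor x b)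
        (fun x => by simp [iw_bxor_assoc]) (fun x => by simp [iw_bxor_assoc])) _ _ (fun x => rfl)).symm
    have e : ∀ x, signOf (q (bxor x b)) * signOf (q (bxor (bxor x b) a)) = -(signOf (q x) * signOf (q (bxor x a))) := by
      intro x
      have hb'' : (q zeroVec ^^ q b ^^ q a ^^ q (bxor a b)) = true := by
        revert hb'; cases q zeroVec <;> cases q a <;> cases q b <;> cases q (bxor a b) <;> decide
      have h := es_second_deriv q hq x b a
      rw [bxor_comm b a, hb''] at h
      rw [h, signOf_xor, signOf_xor, signOf_xor]
      have h1 : signOf (q (bxor x b)) * signOf (q (bxor x b)) = 1 := by rw [← pow_two, signOf_sq]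
      have h2 : signOf true = -1 := by simp [signOf]
      rw [h2]
      linear_combination (signOf (q x) * signOf (q (bxor x a)) * (-1)) * h1
    rw [sum_congr rfl fun x _ => e x, sum_neg_distrib] at hre
    linarith
  -- the twisted character on `R`
  have hψ1 : ∀ y', ∀ a ∈ R, signOf (q zeroVec ^^ q a) * twist a y' = 1 ∨ signOf (q zeroVec ^^ q a) * twist a y' = -1 := by
    intro y' a _
    rcases Simon.twist_eq_one_or a y' with h | h <;> cases (q zeroVec ^^ q a) <;> simp [signOf, h]
  have hψmul : ∀ y', ∀ a ∈ R, ∀ a' ∈ R, signOf (q zeroVec ^^ q (bxor a a')) * twist (bxor a a') y' =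
      signOf (q zeroVec ^^ q a) * twist a y' * (signOf (q zeroVec ^^ q a') * twist a' y') := by
    intro y' a ha a' _
    have h : q (bxor a a') = (q zeroVec ^^ q a ^^ q a' ^^ (q zeroVec ^^ q a ^^ q a' ^^ q (bxor a a'))) := by
      cases q zeroVec <;> cases q a <;> cases q a' <;> cases q (bxor a a') <;> rfl
    rw [(hmemR a).1 ha a'] at h
    have h2 : signOf (q zeroVec ^^ q (bxor a a')) = signOf (q zeroVec ^^ q a) * signOf (q zeroVec ^^ q a') := by
      rw [h, ← signOf_xor]
      congr 1
      cases q zeroVec <;> cases q a <;> cases q a' <;> rfl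
    rw [h2, twist_bxor_left]
    ring
  have hΨ : ∀ y', ∑ a ∈ R, signOf (q zeroVec ^^ q a) * twist a y' = #R ∨
      ∑ a ∈ R, signOf (q zeroVec ^^ q a) * twist a y' = 0 :=
    fun y' => sum_char_subspace hadd (fun a => signOf (q zeroVec ^^ q a) * twist a y') (hψ1 y') (hψmul y')
  -- Wiener–Khinchin: `W² = 2¹⁴ · Σ_R ψ`
  have hWK : ∀ y', W (fun x => signOf (q x)) y' ^ 2 = 16384 * ∑ a ∈ R, signOf (q zeroVec ^^ q a) * twist a y' := by
    intro y'
    have h := W_mul_W_bxor (fun x => signOf (q x)) y' zeroVec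
    rw [bxor_zeroVec] at h
    have hd : ∀ a, dwt (fun x => signOf (q x)) a zeroVec = ∑ x, signOf (q x) * signOf (q (bxor x a)) := by
      intro a
      unfold dwt
      refine sum_congr rfl fun x _ => ?_
      rw [twist_comm, BuzetChailloux.twist_zeroVec_right, mul_one]
    rw [sq, h, sum_congr rfl fun a _ => by rw [hd a], ← sum_filter_add_sum_filter_not univ (fun a => a ∈ R)]
    have hz : ∑ a ∈ univ.filter (fun a => a ∉ R), twist a y' * ∑ x, signOf (q x) * signOf (q (bxor x a)) = 0 :=
      sum_eq_zero fun a ha => by rw [hDoff a (mem_filter.1 ha).2, mul_zero]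
    rw [hz, add_zero]
    have hf : univ.filter (fun a => a ∈ R) = R := by ext a; simp
    rw [hf, mul_sum]
    exact sum_congr rfl fun a ha => by rw [hDon a ha]; ring
  -- `T = a₀ ⊕ supp P ⊆ R`, `#T = 2¹⁰`
  obtain ⟨a₀, ha₀⟩ : (univ.filter fun x : Fin (7 + 7) → Bool => P x = true).Nonempty := by
    rw [← card_pos, hP]; norm_num
  have hPa₀ : P a₀ = true := (mem_filter.1 ha₀).2
  have hinj : Function.Injective (bxor a₀) := fun b b' h => by
    rw [← bxor_bxor_cancel_left a₀ b, h, bxor_bxor_cancel_left]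
  have hTcard : #((univ.filter fun x : Fin (7 + 7) → Bool => P x = true).image (bxor a₀)) = 1024 := by
    rw [card_image_of_injective _ hinj, hP]
  have hTR : (univ.filter fun x : Fin (7 + 7) → Bool => P x = true).image (bxor a₀) ⊆ R := by
    intro t ht
    rw [mem_image] at ht
    obtain ⟨b, hb, rfl⟩ := ht
    exact (hmemR _).2 (hrad a₀ b hPa₀ (mem_filter.1 hb).2)
  -- `#R = 2¹⁰`: a power of two in `[2¹⁰, 2¹²)`, and `2¹¹` is excluded by integrality
  obtain ⟨j, hj, hRj⟩ := sw_card_xorClosed R h0 hadd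
  have hRge : 1024 ≤ #R := hTcard ▸ card_le_card hTR
  have hRlt : #R < 4096 := by norm_num at hR; omega
  have hR' : #R = 1024 ∨ #R = 2048 := by
    interval_cases j <;> norm_num at hRj <;> omega
  have hR1024 : #R = 1024 := by
    rcases hR' with h | h
    · exact h
    · exfalso
      have hex : ∃ y₀, ∑ a ∈ R, signOf (q zeroVec ^^ q a) * twist a y₀ ≠ 0 := by
        by_contra hall
        push Not at hall
        have hPars := fl_parseval14 q
        rw [sum_congr rfl fun y' _ => by rw [hWK y', hall y', mul_zero], sum_const_zero] at hPars
        norm_num at hPars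
      obtain ⟨y₀, hy₀⟩ := hex
      have hΨy : ∑ a ∈ R, signOf (q zeroVec ^^ q a) * twist a y₀ = 2048 := by
        rcases hΨ y₀ with h' | h'
        · rw [h', h]; norm_num
        · exact absurd h' hy₀
      obtain ⟨k, hk⟩ := to_W_int q y₀
      have hsq : ((k ^ 2 : ℤ) : ℝ) = ((2 ^ 25 : ℤ) : ℝ) := by
        push_cast
        rw [← hk, hWK y₀, hΨy]
        norm_num
      exact to_sq_ne_two_pow_25 k (by exact_mod_cast hsq)
  have hRT : (univ.filter fun x : Fin (7 + 7) → Bool => P x = true).image (bxor a₀) = R :=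
    eq_of_subset_of_card_le hTR (by rw [hR1024, hTcard])
  -- `Ĝ = ((−1)^q 1_P)^∧ = (−1)^{q(a₀)} (−1)^{a₀·y} Σ_R ψ`
  have hG : W (fun x => signOf (q x) * (if P x = true then (1 : ℝ) else 0)) y =
      signOf (q a₀) * twist a₀ y * ∑ a ∈ R, signOf (q zeroVec ^^ q a) * twist a y := by
    unfold W
    have e1 : ∀ x, signOf (q x) * (if P x = true then (1 : ℝ) else 0) * twist x y =
        if P x = true then signOf (q x) * twist x y else 0 := by
      intro x; split_ifs <;> ring
    rw [sum_congr rfl fun x _ => e1 x, ← sum_filter]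
    have hET : (univ.filter fun x : Fin (7 + 7) → Bool => P x = true) =
        ((univ.filter fun x : Fin (7 + 7) → Bool => P x = true).image (bxor a₀)).image (bxor a₀) := by
      rw [image_image]
      have hid : (bxor a₀ ∘ bxor a₀) = id := funext fun x => bxor_bxor_cancel_left a₀ x
      rw [hid, image_id]
    rw [hET, sum_image fun x _ x' _ h => hinj h, hRT, mul_sum]
    refine sum_congr rfl fun a ha => ?_
    rw [hper0 a ha a₀, signOf_xor, twist_bxor_left]
    ring
  have hlin : W (fun x => signOf (q x) * (1 - 4 * (if P x = true then (1 : ℝ) else 0))) y =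
      W (fun x => signOf (q x)) y - 4 * W (fun x => signOf (q x) * (if P x = true then (1 : ℝ) else 0)) y := by
    unfold W
    rw [mul_sum, ← sum_sub_distrib]
    exact sum_congr rfl fun x _ => by ring
  rw [hlin, hG]
  rcases hΨ y with h1 | h0'
  · rw [h1, hR1024]
    have hWs : W (fun x => signOf (q x)) y ^ 2 = 4096 ^ 2 := by rw [hWK y, h1, hR1024]; norm_num
    have hst : signOf (q a₀) * twist a₀ y = 1 ∨ signOf (q a₀) * twist a₀ y = -1 := by
      rcases Simon.twist_eq_one_or a₀ y with h | h <;> cases q a₀ <;> simp [signOf, h]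
    have hW' : W (fun x => signOf (q x)) y = 4096 ∨ W (fun x => signOf (q x)) y = -4096 := by
      have hm : (W (fun x => signOf (q x)) y - 4096) * (W (fun x => signOf (q x)) y + 4096) = 0 := by
        nlinarith [hWs]
      rcases mul_eq_zero.1 hm with h | h
      · left; linarith
      · right; linarith
    push_cast
    rcases hW' with h | h <;> rcases hst with h' | h' <;> rw [h, h'] <;> norm_num
  · rw [h0']
    have hWs : W (fun x => signOf (q x)) y = 0 := by
      have h := hWK y
      rw [h0', mul_zero] at h
      exact sq_eq_zero_iff.1 h
    rw [hWs]
    left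
    ring



end Summit.QuantumAdvantage.QuantumAdvantage.Theorems.NearExactIsExact.Negative.TypeOFourierCoreFourteen

end
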